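import Summits.CriticalPhenomena.PercolationContinuityZ3.Theorems.PercNearOneGluingNoHeavyLowerTailSahiGridPatternTwoCoord
import Summits.CriticalPhenomena.PercolationContinuityZ3.Theorems.PercNearOneGluingNoHeavyLowerTailSahiGridPatternIndepSlots
import Summits.CriticalPhenomena.PercolationContinuityZ3.Theorems.PercNearOneGluingNoHeavyLowerTailThreePartitionLift

/-!
# `NoHeavyLowerTail` (crux stmt-CriticalPhenomena-4575), Sahi programme: **THE BOOLEAN SHADOW OF THE PATTERN FUNCTIONAL IS THE
# THREE-PARTITION FUNCTIONAL** — `sStarD (A_𝒰) (A_𝒱) (A_𝒲) = 2^d · N(𝒰,𝒱,𝒲)`; hence `PatternPos d ⟹` three-partition positivity on `Fin d`,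
# and the pattern-side slot theorems give three-partition positivity with one two-coordinate slot

Support file (seat `prim-sahi-p1`, generation 10; `--supports stmt-CriticalPhenomena-4575`).  Pure proofs, no definitions, no `sorry`, standard axioms.
Vocabulary: `…SahiGridPattern` (`Pd`, `sStarD`, `col`, `hZ`, `ind`, `PatternPos`), `…SahiGridPatternTwoCoord` (`sStarD_nonneg_of_twoCoord`), and the
three-partition files of cell prim-l12 / lane prim-ineq-gen-4 `…ThreePartitionAD`, `…ThreePartitionLift` (`tri`, `top`, `dee`, `tee`, `threePartN`,
`ThreePartitionPositivity`, `tri_congr`, `tee_swap12/13`).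

THE MATHEMATICS.  For a family `𝒰 ⊆ 𝒫([d])` let `A_𝒰 := {x ∈ [3]^d : {a : x_a = 2} ∈ 𝒰}` (its BOOLEAN SHADOW in the small cube; an up-set of `[3]^d` when `𝒰` is an
up-set; these are exactly the up-sets generated by `{0,2}`-vectors = unions of orthants `{x : x_a = 2 ∀ a ∈ G}`, census §31's family).  A Latin triple
`(x,y,z)` of `[3]^d` determines the ordered 3-partition `(S₁,S₂,S₃) = ({x=2},{y=2},{z=2})` of `[d]`, each ordered 3-partition arising from exactly `2^d` Latin
triples (`card_fibre_twoSets`), and the three-copy kernel `h` evaluated on shadows is the integrand of the three-partition functional.  Hence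
**`sStarD_shadow_eq`**: `sStarD A_𝒰 A_𝒱 A_𝒲 = 2^d · threePartN 𝒰 𝒱 𝒲` (`N = 2·top(𝒰∩𝒱∩𝒲) + tee − Σ dee`, `…ThreePartitionAD`), for ALL families (no up-set
hypothesis).  CONSEQUENCES: `threePartN_nonneg_of_patternPos` (`PatternPos d ⟹ N(𝒰,𝒱,𝒲) ≥ 0` for all up-set families on `Fin d`; so
`ThreePartitionPositivity` is the Boolean shadow of the pattern conjecture, and census §31's 'PatternPos₅ on unions of orthants, exhaustive' is three-partition
positivity at `m = 5`); and, unconditionally from the pattern-side slot theorems, **`threePartN_nonneg_of_twoCoord`**: `N(𝒰,𝒱,𝒲) ≥ 0` for all up-set families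
`𝒱, 𝒲` whenever membership in the up-set family `𝒰` is decided by two elements `i ≠ j` (`𝒰 = {S : i ∈ S}`, `{S : i ∈ S ∨ j ∈ S}`, `{S : i ∈ S ∧ j ∈ S}` — a stratum of
three-partition positivity not among 'comparable / principal / independent / disjoint supports / meet-containing'), and **`threePartN_nonneg_of_indepSlots`**:
`N(𝒰,𝒱,𝒲) ≥ 0` whenever membership in `𝒰` depends only on `S ∩ J` and membership in `𝒱` only on `S ∖ J` (independent pair; `…SahiGridPatternIndepSlots`).
HONEST LABEL: `ThreePartitionPositivity`, `PatternPos d` (`d ≥ 4`), Sahi's `C₃` and Kahn's conjecture remain OPEN; nothing here asserts them. [this work]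
-/

noncomputable section

open Finset
open scoped Classical

namespace Summit.CriticalPhenomena.PercolationContinuityZ3.Theorems.SahiGridPattern

open SahiGrid3 (ind hZ)
open Summit.CriticalPhenomena.PercolationContinuityZ3.Theorems.ThreePartition

variable {d : ℕ}

/-! ### The 2-sets of a Latin triple -/

/-- In `S₃`: `σ 2 = 2 ↔ σ 0 ≠ 2 ∧ σ 1 ≠ 2`. [this work] -/
theorem perm_two_eq_two_iff (σ : Equiv.Perm (Fin 3)) : σ 2 = 2 ↔ (σ 0 ≠ 2 ∧ σ 1 ≠ 2) := by
  constructor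
  · intro h
    exact ⟨fun h0 => absurd (σ.injective (h0.trans h.symm)) (by decide), fun h1 => absurd (σ.injective (h1.trans h.symm)) (by decide)⟩
  · rintro ⟨h0, h1⟩
    obtain ⟨c, hc⟩ := σ.surjective 2
    have : c = 2 := by
      fin_cases c
      · exact absurd hc h0
      · exact absurd hc h1
      · rfl
    subst this; exact hc

/-- The third 2-set of a Latin triple is the complement of the first two. [this work] -/
theorem twoSet_col_two (π : Fin d → Equiv.Perm (Fin 3)) :
    {a : Fin d | col π 2 a = 2} = ({a : Fin d | col π 0 a = 2} ∪ {a : Fin d | col π 1 a = 2})ᶜ := by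
  ext a
  simp only [Set.mem_setOf_eq, Set.mem_compl_iff, Set.mem_union, not_or]
  exact perm_two_eq_two_iff (π a)

/-- The first two 2-sets of a Latin triple are disjoint. [this work] -/
theorem disjoint_twoSet_col (π : Fin d → Equiv.Perm (Fin 3)) :
    Disjoint {a : Fin d | col π 0 a = 2} {a : Fin d | col π 1 a = 2} := by
  rw [Set.disjoint_iff]
  rintro a ⟨h0, h1⟩
  exact absurd ((π a).injective ((h0 : π a 0 = 2).trans (h1 : π a 1 = 2).symm)) (by decide)

/-- Per-axis fibre counts: the number of `σ ∈ S₃` with prescribed truth values of `σ 0 = 2`, `σ 1 = 2`. [this work] -/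
theorem card_perm_fibre (P Q : Prop) :
    (univ.filter fun σ : Equiv.Perm (Fin 3) => (σ 0 = 2 ↔ P) ∧ (σ 1 = 2 ↔ Q)).card = if P ∧ Q then 0 else 2 := by
  by_cases hP : P <;> by_cases hQ : Q
  · simp only [hP, hQ, iff_true, and_self, if_true]
    rw [Finset.card_eq_zero, Finset.filter_eq_empty_iff]
    rintro σ - ⟨h0, h1⟩
    exact absurd (σ.injective (h0.trans h1.symm)) (by decide)
  · simp only [hP, hQ, iff_true, iff_false, and_false, if_false]
    decide
  · simp only [hP, hQ, iff_true, iff_false, false_and, if_false]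
    decide
  · simp only [hP, hQ, iff_false, and_self, if_false]
    decide

/-- **Each ordered 3-partition comes from exactly `2^d` Latin triples** (and a non-disjoint pair from none). [this work] -/
theorem card_fibre_twoSets (S₁ S₂ : Set (Fin d)) :
    (univ.filter fun π : Fin d → Equiv.Perm (Fin 3) =>
        ({a : Fin d | col π 0 a = 2}, {a : Fin d | col π 1 a = 2}) = (S₁, S₂)).card = if Disjoint S₁ S₂ then 2 ^ d else 0 := by
  have e : (univ.filter fun π : Fin d → Equiv.Perm (Fin 3) => ({a : Fin d | col π 0 a = 2}, {a : Fin d | col π 1 a = 2}) = (S₁, S₂)) =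
      Fintype.piFinset fun a => univ.filter fun σ : Equiv.Perm (Fin 3) => (σ 0 = 2 ↔ a ∈ S₁) ∧ (σ 1 = 2 ↔ a ∈ S₂) := by
    ext π
    simp only [Finset.mem_filter, Finset.mem_univ, true_and, Fintype.mem_piFinset, Prod.mk.injEq, Set.ext_iff, Set.mem_setOf_eq]
    exact ⟨fun ⟨h0, h1⟩ a => ⟨h0 a, h1 a⟩, fun h => ⟨fun a => (h a).1, fun a => (h a).2⟩⟩
  rw [e, Fintype.card_piFinset]
  simp only [card_perm_fibre]
  by_cases hd : Disjoint S₁ S₂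
  · rw [if_pos hd]
    have : ∀ a : Fin d, (if (a ∈ S₁ ∧ a ∈ S₂) then 0 else 2) = 2 := by
      intro a
      rw [if_neg]
      rintro ⟨h1, h2⟩
      exact (Set.disjoint_iff.1 hd) ⟨h1, h2⟩
    rw [Finset.prod_congr rfl fun a _ => this a, Finset.prod_const, Finset.card_univ, Fintype.card_fin]
  · rw [if_neg hd]
    rw [Set.not_disjoint_iff] at hd
    obtain ⟨a, h1, h2⟩ := hd
    exact Finset.prod_eq_zero (Finset.mem_univ a) (by rw [if_pos ⟨h1, h2⟩])

/-! ### The three-copy kernel on shadows -/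

/-- Indicator of a shadow set at a column of a Latin triple. [this work] -/
theorem ind_shadow_col {𝒰 : Set (Set (Fin d))} {A : Finset (Pd d)} (hA : ∀ x : Pd d, x ∈ A ↔ {a : Fin d | x a = 2} ∈ 𝒰)
    (π : Fin d → Equiv.Perm (Fin 3)) (c : Fin 3) :
    ind A (col π c) = if {a : Fin d | col π c a = 2} ∈ 𝒰 then 1 else 0 := by
  unfold ind
  exact if_congr (hA _) rfl rfl

/-- A `tee` count as a sum of an indicator over all pairs. [this work] -/
theorem tee_eq_sum (𝒳 𝒴 𝒵 : Set (Set (Fin d))) :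
    (tee 𝒳 𝒴 𝒵 : ℤ) = ∑ q : Set (Fin d) × Set (Fin d),
      if Disjoint q.1 q.2 ∧ (q.1 ∈ 𝒳 ∧ q.2 ∈ 𝒴 ∧ (q.1 ∪ q.2)ᶜ ∈ 𝒵) then (1:ℤ) else 0 := by
  unfold ThreePartition.tee ThreePartition.tri
  rw [Finset.card_filter]
  push_cast
  exact Finset.sum_congr rfl fun q _ => if_congr Iff.rfl rfl rfl

/-- `top` as a `tee` with the family in the FIRST part. [this work] -/
theorem top_eq_tee (𝒞 : Set (Set (Fin d))) : top 𝒞 = tee 𝒞 Set.univ Set.univ := by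
  rw [tee_swap13]
  unfold top tee
  exact tri_congr fun S₁ S₂ _ => by simp

/-- `dee` as a `tee` with the second family in the SECOND part. [this work] -/
theorem dee_eq_tee (𝒜 ℬ : Set (Set (Fin d))) : dee 𝒜 ℬ = tee 𝒜 ℬ Set.univ := by
  have h : dee 𝒜 ℬ = tee 𝒜 Set.univ ℬ := by
    unfold dee tee
    exact tri_congr fun S₁ S₂ _ => by simp
  rw [h, tee_swap12 𝒜 Set.univ ℬ, tee_swap13 Set.univ 𝒜 ℬ, tee_swap12 ℬ 𝒜 Set.univ]

/-- **THE SHADOW IDENTITY**: for all families `𝒰, 𝒱, 𝒲 ⊆ 𝒫([d])` and their shadows `A_𝒰 = {x : {x=2} ∈ 𝒰}` etc. in `[3]^d`,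
`sStarD A_𝒰 A_𝒱 A_𝒲 = 2^d · threePartN 𝒰 𝒱 𝒲`. [this work] -/
theorem sStarD_shadow_eq (𝒰 𝒱 𝒲 : Set (Set (Fin d))) {A B C : Finset (Pd d)}
    (hA : ∀ x : Pd d, x ∈ A ↔ {a : Fin d | x a = 2} ∈ 𝒰) (hB : ∀ x : Pd d, x ∈ B ↔ {a : Fin d | x a = 2} ∈ 𝒱)
    (hC : ∀ x : Pd d, x ∈ C ↔ {a : Fin d | x a = 2} ∈ 𝒲) :
    sStarD A B C = 2 ^ d * threePartN 𝒰 𝒱 𝒲 := by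
  -- the kernel as a function of the pair of 2-sets
  let a𝒰 : Set (Fin d) → ℤ := fun S => if S ∈ 𝒰 then 1 else 0
  let a𝒱 : Set (Fin d) → ℤ := fun S => if S ∈ 𝒱 then 1 else 0
  let a𝒲 : Set (Fin d) → ℤ := fun S => if S ∈ 𝒲 then 1 else 0
  let K : Set (Fin d) × Set (Fin d) → ℤ := fun q =>
    2 * (a𝒰 q.1 * a𝒱 q.1 * a𝒲 q.1) - a𝒰 q.1 * a𝒱 q.2 * a𝒲 q.2 - a𝒱 q.1 * a𝒰 q.2 * a𝒲 q.2 - a𝒲 q.1 * a𝒰 q.2 * a𝒱 q.2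
      + a𝒰 q.1 * a𝒱 q.2 * a𝒲 (q.1 ∪ q.2)ᶜ
  let Φ : (Fin d → Equiv.Perm (Fin 3)) → Set (Fin d) × Set (Fin d) := fun π => ({a | col π 0 a = 2}, {a | col π 1 a = 2})
  have hker : ∀ π : Fin d → Equiv.Perm (Fin 3), hZ A B C (col π 0) (col π 1) (col π 2) = K (Φ π) := by
    intro π
    unfold hZ
    rw [ind_shadow_col hA π 0, ind_shadow_col hA π 1, ind_shadow_col hB π 0, ind_shadow_col hB π 1, ind_shadow_col hC π 0,
      ind_shadow_col hC π 1, ind_shadow_col hC π 2, twoSet_col_two]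
  -- fibre counting
  have hsum : sStarD A B C = 2 ^ d * ∑ q : Set (Fin d) × Set (Fin d), (if Disjoint q.1 q.2 then (1:ℤ) else 0) * K q := by
    unfold sStarD
    rw [Finset.sum_congr rfl fun π _ => hker π, ← Finset.sum_fiberwise univ Φ (fun π => K (Φ π)), Finset.mul_sum]
    refine Finset.sum_congr rfl fun q _ => ?_
    rw [Finset.sum_congr rfl fun π hπ => by rw [(Finset.mem_filter.1 hπ).2], Finset.sum_const, nsmul_eq_mul]
    obtain ⟨S₁, S₂⟩ := q
    rw [card_fibre_twoSets S₁ S₂]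
    split_ifs <;> simp
  -- the three-partition functional as a sum over pairs
  have hN : threePartN 𝒰 𝒱 𝒲 = ∑ q : Set (Fin d) × Set (Fin d), (if Disjoint q.1 q.2 then (1:ℤ) else 0) * K q := by
    unfold threePartN
    rw [top_eq_tee, dee_eq_tee, dee_eq_tee, dee_eq_tee]
    push_cast
    rw [tee_eq_sum, tee_eq_sum, tee_eq_sum, tee_eq_sum, tee_eq_sum, Finset.mul_sum, ← Finset.sum_add_distrib, ← Finset.sum_add_distrib,
      ← Finset.sum_add_distrib, ← Finset.sum_sub_distrib]
    refine Finset.sum_congr rfl fun q _ => ?_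
    simp only [K, a𝒰, a𝒱, a𝒲, Set.mem_inter_iff, Set.mem_univ, and_true, ite_and_eq_mul]
    ring
  rw [hsum, hN]

/-! ### Consequences -/

/-- The shadow of an up-set family is an up-set of `[3]^d`. [this work] -/
theorem isUpperSet_shadow {𝒰 : Set (Set (Fin d))} (h𝒰 : IsUpperSet 𝒰) :
    IsUpperSet ((univ.filter fun x : Pd d => {a : Fin d | x a = 2} ∈ 𝒰 : Finset (Pd d)) : Set (Pd d)) := by
  intro x y hxy hx
  rw [Finset.mem_coe, Finset.mem_filter] at hx ⊢
  refine ⟨Finset.mem_univ _, h𝒰 (fun a (ha : x a = 2) => ?_) hx.2⟩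
  have h2 : (2 : Fin 3) ≤ y a := by rw [← ha]; exact hxy a
  show y a = 2
  exact le_antisymm (Fin.le_last _) h2

/-- **`PatternPos d ⟹` three-partition positivity on the ground set `Fin d`.** [this work] -/
theorem threePartN_nonneg_of_patternPos (hP : PatternPos d) {𝒰 𝒱 𝒲 : Set (Set (Fin d))} (h𝒰 : IsUpperSet 𝒰) (h𝒱 : IsUpperSet 𝒱)
    (h𝒲 : IsUpperSet 𝒲) : 0 ≤ threePartN 𝒰 𝒱 𝒲 := by
  have h := hP _ _ _ (isUpperSet_shadow h𝒰) (isUpperSet_shadow h𝒱) (isUpperSet_shadow h𝒲)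
  rw [sStarD_shadow_eq 𝒰 𝒱 𝒲 (fun x => by simp) (fun x => by simp) (fun x => by simp)] at h
  exact nonneg_of_mul_nonneg_right (by rwa [mul_comm] at h) (by positivity)

/-- **Three-partition positivity with one two-coordinate slot** (every finite ground set `Fin d`, unconditional): if membership in the up-set family `𝒰`
is decided by two elements `i ≠ j`, then `threePartN 𝒰 𝒱 𝒲 ≥ 0` for all up-set families `𝒱, 𝒲`. [this work] -/
theorem threePartN_nonneg_of_twoCoord (i j : Fin d) (hij : i ≠ j) {𝒰 𝒱 𝒲 : Set (Set (Fin d))} (h𝒰 : IsUpperSet 𝒰)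
    (hdep : ∀ S T : Set (Fin d), (i ∈ S ↔ i ∈ T) → (j ∈ S ↔ j ∈ T) → (S ∈ 𝒰 ↔ T ∈ 𝒰)) (h𝒱 : IsUpperSet 𝒱) (h𝒲 : IsUpperSet 𝒲) :
    0 ≤ threePartN 𝒰 𝒱 𝒲 := by
  have h := sStarD_nonneg_of_twoCoord i j hij (isUpperSet_shadow h𝒰) (fun x y hi hj => by
      rw [Finset.mem_filter, Finset.mem_filter]
      simp only [Finset.mem_univ, true_and]
      exact hdep _ _ (by simp [hi]) (by simp [hj]))
    _ _ (isUpperSet_shadow h𝒱) (isUpperSet_shadow h𝒲)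
  rw [sStarD_shadow_eq 𝒰 𝒱 𝒲 (fun x => by simp) (fun x => by simp) (fun x => by simp)] at h
  exact nonneg_of_mul_nonneg_right (by rwa [mul_comm] at h) (by positivity)

/-- **Three-partition positivity with two independent slots** (every finite ground set `Fin d`, unconditional): if membership in the up-set family `𝒰`
depends only on `S ∩ J` and membership in the up-set family `𝒱` only on `S ∖ J`, then `threePartN 𝒰 𝒱 𝒲 ≥ 0` for every up-set family `𝒲`. [this work] -/
theorem threePartN_nonneg_of_indepSlots (J : Finset (Fin d)) {𝒰 𝒱 𝒲 : Set (Set (Fin d))} (h𝒰 : IsUpperSet 𝒰) (h𝒱 : IsUpperSet 𝒱)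
    (h𝒲 : IsUpperSet 𝒲) (hdep𝒰 : ∀ S T : Set (Fin d), (∀ a ∈ J, (a ∈ S ↔ a ∈ T)) → (S ∈ 𝒰 ↔ T ∈ 𝒰))
    (hdep𝒱 : ∀ S T : Set (Fin d), (∀ a ∉ J, (a ∈ S ↔ a ∈ T)) → (S ∈ 𝒱 ↔ T ∈ 𝒱)) :
    0 ≤ threePartN 𝒰 𝒱 𝒲 := by
  have h := sStarD_nonneg_of_indepSlots J (isUpperSet_shadow h𝒰) (isUpperSet_shadow h𝒱) (isUpperSet_shadow h𝒲)
    (fun x y hxy => by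
      rw [Finset.mem_filter, Finset.mem_filter]
      simp only [Finset.mem_univ, true_and]
      exact hdep𝒰 _ _ fun a ha => by simp [hxy a ha])
    (fun x y hxy => by
      rw [Finset.mem_filter, Finset.mem_filter]
      simp only [Finset.mem_univ, true_and]
      exact hdep𝒱 _ _ fun a ha => by simp [hxy a ha])
  rw [sStarD_shadow_eq 𝒰 𝒱 𝒲 (fun x => by simp) (fun x => by simp) (fun x => by simp)] at h
  exact nonneg_of_mul_nonneg_right (by rwa [mul_comm] at h) (by positivity)

end Summit.CriticalPhenomena.PercolationContinuityZ3.Theorems.SahiGridPattern
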